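import Mathlib.MeasureTheory.Group.Action
import Mathlib.MeasureTheory.Measure.Restrict
import Mathlib.MeasureTheory.Measure.Typeclasses.Finite
import Mathlib.GroupTheory.GroupAction.Basic

/-!
# Invariant measures restrict to invariant pieces (Tier 5, N4.3 (A3) STEP 1)

Kernel form of the measure sentence of route/T5-N4-p5.md (A3) STEP 1 (l. 147):

«The Haar measure of `G(𝔸)` induces `G_∞`-invariant measures on the orbits».

Abstract setting: a group `G` acting on a measurable space `α` and a `G`-invariant measure `μ`
(Mathlib's `SMulInvariantMeasure G α μ`). Then

* every orbit `orbit G y` is a `G`-invariant set: `(g • ·) ⁻¹' orbit G y = orbit G y`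
  (`preimage_smul_orbit`, `smul_mem_orbit_iff`);
* the restriction `μ.restrict O` of `μ` to a `G`-invariant set `O` is again `G`-invariant
  (`smulInvariantMeasure_restrict` when the action is measurable,
  `smulInvariantMeasure_restrict_of_measurableSet` when `O` is measurable);
* in particular the restriction of `μ` to each orbit is `G`-invariant
  (`smulInvariantMeasure_restrict_orbit`), and it is a FINITE measure as soon as the orbit is
  compact and `μ` is finite on compacts (`isFiniteMeasure_restrict_orbit`) — the situation of
  STEP 1, where the orbits are compact (`T5CompactOpenOrbits`) and the induced measure on
  `Y = G(F)\G(𝔸)/K_f` is `G_∞`-invariant.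

What stays prose: that the measure induced on the quotient `Y` by the Haar measure of `G(𝔸)` is
`G_∞`-invariant (the construction of the quotient measure). Everything here is Mathlib-only.
-/

namespace Summit.Ventures.HodgeRepro2.T5InvariantMeasureRestrict

open MeasureTheory Set MulAction

variable {G α : Type*} [Group G] [MulAction G α]

section Orbit

/-- Orbits are invariant sets: `g • x` lies in the orbit of `y` iff `x` does. -/
theorem smul_mem_orbit_iff (g : G) (x y : α) : g • x ∈ orbit G y ↔ x ∈ orbit G y := by
  rw [← orbit_eq_iff, ← orbit_eq_iff, orbit_smul]

/-- The preimage of an orbit under `g • ·` is the orbit itself. -/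
theorem preimage_smul_orbit (g : G) (y : α) : (g • ·) ⁻¹' orbit G y = orbit G y := by
  ext x
  exact smul_mem_orbit_iff g x y

end Orbit

section Restrict

variable {m : MeasurableSpace α} (μ : Measure α) [SMulInvariantMeasure G α μ]

/-- For a `G`-invariant set `O`, `(c • ·) ⁻¹' s ∩ O = (c • ·) ⁻¹' (s ∩ O)`. -/
theorem preimage_smul_inter_of_preimage_eq {O : Set α} (hO : ∀ g : G, (g • ·) ⁻¹' O = O) (c : G)
    (s : Set α) : (c • ·) ⁻¹' s ∩ O = (c • ·) ⁻¹' (s ∩ O) := by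
  rw [preimage_inter, hO c]

/-- The restricted measure of the translate of a measurable set equals that of the set, for a
`G`-invariant `O` and a measurable action. -/
theorem restrict_apply_preimage_smul [MeasurableConstSMul G α] {O : Set α}
    (hO : ∀ g : G, (g • ·) ⁻¹' O = O) (c : G) {s : Set α} (hs : MeasurableSet s) :
    μ.restrict O ((c • ·) ⁻¹' s) = μ.restrict O s := by
  rw [Measure.restrict_apply (hs.preimage (measurable_const_smul c)), Measure.restrict_apply hs,
    preimage_smul_inter_of_preimage_eq hO, measure_preimage_smul]

/-- **The restriction of a `G`-invariant measure to a `G`-invariant set is `G`-invariant**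
(measurable action; no measurability of `O` needed). -/
theorem smulInvariantMeasure_restrict [MeasurableConstSMul G α] {O : Set α}
    (hO : ∀ g : G, (g • ·) ⁻¹' O = O) : SMulInvariantMeasure G α (μ.restrict O) :=
  ⟨fun c _ hs => restrict_apply_preimage_smul μ hO c hs⟩

/-- **The restriction of a `G`-invariant measure to a `G`-invariant measurable set is
`G`-invariant** (no measurability of the action needed). -/
theorem smulInvariantMeasure_restrict_of_measurableSet {O : Set α} (hOm : MeasurableSet O)
    (hO : ∀ g : G, (g • ·) ⁻¹' O = O) : SMulInvariantMeasure G α (μ.restrict O) :=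
  ⟨fun c s _ => by
    rw [Measure.restrict_apply' hOm, Measure.restrict_apply' hOm,
      preimage_smul_inter_of_preimage_eq hO, measure_preimage_smul]⟩

/-- **STEP 1: the invariant measure restricted to an orbit is invariant.** -/
theorem smulInvariantMeasure_restrict_orbit [MeasurableConstSMul G α] (y : α) :
    SMulInvariantMeasure G α (μ.restrict (orbit G y)) :=
  smulInvariantMeasure_restrict μ fun g => preimage_smul_orbit g y

/-- The same for the orbit of a point of the orbit space. -/
theorem smulInvariantMeasure_restrict_orbit' [MeasurableConstSMul G α]
    (q : orbitRel.Quotient G α) : SMulInvariantMeasure G α (μ.restrict q.orbit) := by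
  rw [orbitRel.Quotient.orbit_eq_orbit_out q Quotient.out_eq']
  exact smulInvariantMeasure_restrict_orbit μ _

end Restrict

section Finite

variable {m : MeasurableSpace α} [TopologicalSpace α] (μ : Measure α)
  [IsFiniteMeasureOnCompacts μ]

/-- A compact orbit has finite measure for a measure finite on compacts. -/
theorem measure_orbit_lt_top {y : α} (h : IsCompact (orbit G y)) : μ (orbit G y) < ⊤ :=
  h.measure_lt_top

/-- **The restriction to a compact orbit is a finite measure** (STEP 1: the orbits of `G_∞` on the
compact `Y` are compact, so each `L²(Γ_i\G_∞)` is taken for a finite invariant measure). -/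
theorem isFiniteMeasure_restrict_orbit {y : α} (h : IsCompact (orbit G y)) :
    IsFiniteMeasure (μ.restrict (orbit G y)) :=
  isFiniteMeasure_restrict.mpr (measure_orbit_lt_top μ h).ne

end Finite

end Summit.Ventures.HodgeRepro2.T5InvariantMeasureRestrict
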